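import Summits.BirchSwinnertonDyer.Rank1Residual.P2.CongruentNumberSilentEvenFiveAokiSymbols
import Summits.BirchSwinnertonDyer.Rank1Residual.P2.CongruentNumberSilentEvenFiveEnclosureSelmerBound
import Summits.BirchSwinnertonDyer.Rank1Residual.P2.CongruentNumberEvenFiveFamilyMonskyEven
import HarnessLib

/-!
# Cell `bsd-monsky`: `#Sel₂(E_{2pq}) = 8` on the whole even-five two-prime family from Aoki 1999
# Theorem 2.2 (refereed, completely proved in print), and the enclosure corners of C-P2-1 with Aoki's
# fact `hAo` in place of the sketch-proved `hMe` / the in-house bound `hD` (nothing asserted)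

HONEST FRAMING (cell `bsd-monsky`, run/shared/lean/pub/bsd-monsky/, README §1: ONE theorem on ONE
explicit infinite family of quadratic twists of the congruent number curve at the prime `2`; not
"BSD for rank ≤ 1", nothing at odd primes, nothing booked until the cross-family referee passes the
written proof). This file asserts NO arithmetic fact. It evaluates, in the kernel, the named fact
`Aoki1999.thm22_card_selmerGroup_two` (`hAo`: Aoki, Comment. Math. Univ. St. Pauli 48 (1999), Thm. 2.2,
the closed formula `dim Sel^(2)(E^(n)/ℚ) = 1 + |S| + |T| − 2 rank Λ_{S,T} − rank ᵗΦ(…)Φ`; a refereed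
journal article with complete proofs — unlike the tree's other input for the same quantity,
`HeathBrown1994.monsky_card_selmerGroup_two_even`, whose even case is printed as "a sketch proof") on
`n = 2pq`, `p ≡ 5 (mod 8)`, `q ≡ 3 (mod 4)` primes, BOTH Legendre halves, using the symbols of the
companion file `P2/CongruentNumberSilentEvenFiveAokiSymbols.lean`:

* §1 `|S| = 3`, `|T| = 1`; `rank Λ_{S,T} = 1` (the column `(λ_p(2), λ_p(p), λ_p(q))` has `λ_p(2) = 1`);
  the Gram matrix of `( , )_V` on `v_{S₁}(Sel₀^(φ′))` is ZERO — for `(q/p) = −1` every essential `w` has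
  `w_q = 0` and `(p, p)_V = λ_q(p) + λ₂(p) = 1 + 1 = 0`, for `(q/p) = +1` every essential `w` has
  `w_p = 0` and `(q, q)_V = λ_q(q) + λ₂(q) = 0` (Lemma 7.3 made explicit); hence
  `dim Sel^(2)(E_{2pq}/ℚ) = 1 + 3 + 1 − 2 − 0 = 3`, i.e. **`#Sel₂(E_{2pq}) = 8`**
  (`card_selmerGroup_two_two_mul_five_mul_of_aoki`) — the exact count of the lit seat's sheet
  (run/shared/lean/pub/bsd-monsky/lit/AOKI1999-TWO-SELMER-SHEET.md), now a kernel theorem modulo `hAo`.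
* §2 the enclosure corners: `hAo` implies the written proof's bound `hD` (`#Sel₂ ≤ 8` on `𝒮⁻`), so every
  landed `hD`-corner of `P2/…EnclosureSelmerBound.lean` / `…DatumMonskyEven.lean` has an `hAo`-twin:
  the odd-index Heegner datum on `𝒮⁻` from the system, rank one / `#Sel₂ = 8` / `Ш[2^∞] = 0` in the
  kernel, and **C-P2-1 (`CongruentSilentEvenFiveOrdTwo`, `CongruentSilentEvenFiveBSDTwo`) modulo
  `{hAo, hSys}` and `{hAo, hSys′}`** — route A's displayed content becomes the system fact plus ONE
  refereed, fully proved printed theorem (no Monsky 1990 binder, no Heath-Brown 1994 binder).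
* §3 the `𝒮⁺` half (`(p/q) = +1`, U⁺ discharged by TYZ) with `hAo` in place of `hMe`, and the whole
  family `BSD(E_{2pq}, 2)` for ALL `p ≡ 5 (mod 8)`, `q ≡ 3 (mod 4)` modulo `{hTYZ, hGZK, hR, hAo, hSys′}`.

What stays displayed for the `𝒮⁻` enclosure after this file: `hSys′` (Tian 2014 Thm 2.8 system in genus
form) and ONE of `hAo` (Aoki 1999 Thm 2.2, full proof in print), `hMe` (HB94 appendix, even case a sketch),
`hD` (PROOF-A App. D, in-house; Lagrange 1975 / Aoki 1999 print the same classes). Nothing asserted.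
References: [Aoki1999] Thm. 2.2 p. 81, proof p. 98, Thm. 4.1 p. 87, Lemma 7.3 pp. 98–99; [SilvermanAEC2009]
Thm. X.4.2, Thm. VIII.6.7; [Tian2014] Thm. 2.8; [TianYuanZhang2017] Thm. 1.2, 3.3, 3.5; [Miller2011LMS] Def. 1.1.
-/

noncomputable section

open scoped Classical

open WeierstrassCurve Literature.NumberTheory.EllipticCurves
  Literature.NumberTheory.EllipticCurves.Aoki1999
  Literature.NumberTheory.EllipticCurves.Rank1Residual
  Literature.NumberTheory.EllipticCurves.Rank1Residual.Typed
  Literature.NumberTheory.EllipticCurves.HeathBrown1994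
  Literature.NumberTheory.EllipticCurves.HeathBrown1994.Families
  Literature.NumberTheory.EllipticCurves.Monsky1990
  Literature.NumberTheory.EllipticCurves.TianYuanZhang2017
  Literature.NumberTheory.QuadraticFields.RedeiReichardt
  Literature.NumberTheory.QuadraticForms

set_option autoImplicit false

namespace Summit.BirchSwinnertonDyer.Rank1Residual.P2

open Conjectures Literature.NumberTheory.EllipticCurves.Tian2014

/-! ## §1 The evaluation of Theorem 2.2 on `n = 2pq`: `|S| = 3`, `|T| = 1`, `rank Λ_{S,T} = 1`, the Gram
matrix on `v_{S₁}(Sel₀)` is zero — so `dim Sel^(2)(E_{2pq}/ℚ) = 1 + 3 + 1 − 2 − 0 = 3` -/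

section Evaluation

variable {p q : ℕ}

/-- `2 ∈ S`. [cite: Aoki1999, §2 p. 80] -/
theorem two_mem_sSet (hp : p.Prime) (hq : q.Prime) : 2 ∈ sSet (2 * (p * q)) := by
  rw [sSet_two_mul_five_mul hp hq]
  simp

/-- `p ∈ T`. [cite: Aoki1999, §2 p. 80] -/
theorem prime_mem_tSet (hp : p.Prime) (hq : q.Prime) (hp8 : p % 8 = 5) (hq4 : q % 4 = 3) :
    p ∈ tSet (2 * (p * q)) := by
  rw [tSet_two_mul_five_mul hp hq hp8 hq4]
  simp

/-- `p ∈ S₁`. [cite: Aoki1999, §2 p. 80] -/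
theorem prime_mem_sOneSet (hp : p.Prime) (hq : q.Prime) (hp8 : p % 8 = 5) (hq4 : q % 4 = 3) :
    p ∈ sOneSet (2 * (p * q)) := by
  rw [sOneSet_two_mul_five_mul hp hq hp8 hq4]
  simp

/-- `q ∈ S₁`. [cite: Aoki1999, §2 p. 80] -/
theorem other_mem_sOneSet (hp : p.Prime) (hq : q.Prime) (hp8 : p % 8 = 5) (hq4 : q % 4 = 3) :
    q ∈ sOneSet (2 * (p * q)) := by
  rw [sOneSet_two_mul_five_mul hp hq hp8 hq4]
  simp

/-- `q ∈ S₂`. [cite: Aoki1999, Thm. 2.2 p. 81] -/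
theorem other_mem_sTwoSet (hp : p.Prime) (hq : q.Prime) (hp8 : p % 8 = 5) (hq4 : q % 4 = 3) :
    q ∈ sTwoSet (2 * (p * q)) := by
  rw [sTwoSet_two_mul_five_mul hp hq hp8 hq4]
  simp

/-- `|S| = 3`. [cite: Aoki1999, §2 p. 80] -/
theorem card_sSet_two_mul_five_mul (hp : p.Prime) (hq : q.Prime) (hp8 : p % 8 = 5) (hq4 : q % 4 = 3) :
    (sSet (2 * (p * q))).card = 3 := by
  rw [sSet_two_mul_five_mul hp hq, Finset.card_insert_of_notMem, Finset.card_pair (by omega)]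
  simp only [Finset.mem_insert, Finset.mem_singleton, not_or]
  omega

/-- `|T| = 1`. [cite: Aoki1999, §2 p. 80] -/
theorem card_tSet_two_mul_five_mul (hp : p.Prime) (hq : q.Prime) (hp8 : p % 8 = 5) (hq4 : q % 4 = 3) :
    (tSet (2 * (p * q))).card = 1 := by
  rw [tSet_two_mul_five_mul hp hq hp8 hq4, Finset.card_singleton]

/-- A sum over the two-element index type `↥S₁ = {p, q}`. [folklore] -/
theorem sum_sOneSet_eq (hp : p.Prime) (hq : q.Prime) (hp8 : p % 8 = 5) (hq4 : q % 4 = 3)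
    (f : sOneSet (2 * (p * q)) → ZMod 2) :
    ∑ x, f x = f ⟨p, prime_mem_sOneSet hp hq hp8 hq4⟩ + f ⟨q, other_mem_sOneSet hp hq hp8 hq4⟩ := by
  apply Fintype.sum_eq_add
  · intro h
    have := congrArg Subtype.val h
    simp only at this
    omega
  · rintro ⟨x, hx⟩ ⟨h1, h2⟩
    exfalso
    rw [sOneSet_two_mul_five_mul hp hq hp8 hq4, Finset.mem_insert, Finset.mem_singleton] at hx
    rcases hx with rfl | rfl
    · exact h1 rfl
    · exact h2 rfl

/-- A sum over the one-element index type `↥S₂ = {q}`. [folklore] -/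
theorem sum_sTwoSet_eq (hp : p.Prime) (hq : q.Prime) (hp8 : p % 8 = 5) (hq4 : q % 4 = 3)
    (f : sTwoSet (2 * (p * q)) → ZMod 2) :
    ∑ x, f x = f ⟨q, other_mem_sTwoSet hp hq hp8 hq4⟩ := by
  apply Fintype.sum_eq_single
  rintro ⟨x, hx⟩ h1
  exfalso
  rw [sTwoSet_two_mul_five_mul hp hq hp8 hq4, Finset.mem_singleton] at hx
  subst hx
  exact h1 rfl

/-- **`rank Λ_{S,T} = 1`** on the family: `T = {p}` and the entry `λ_p(2) = 1` is non-zero.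
[cite: Aoki1999, Thm. 2.1 p. 80] -/
theorem rank_lamMatrix_two_mul_five_mul (hp : p.Prime) (hq : q.Prime) (hp8 : p % 8 = 5)
    (hq4 : q % 4 = 3) :
    (lamMatrix (2 * (p * q)) (sSet (2 * (p * q))) (tSet (2 * (p * q)))).rank = 1 := by
  refine rank_eq_one_of_card_eq_one _ ?_ (i := ⟨2, two_mem_sSet hp hq⟩)
    (j := ⟨p, prime_mem_tSet hp hq hp8 hq4⟩) ?_
  · rw [Fintype.card_coe, card_tSet_two_mul_five_mul hp hq hp8 hq4]
  · show lam (2 * (p * q)) p ((2 : ℕ) : ℤ) ≠ 0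
    rw [Nat.cast_ofNat, lam_prime_two hp hq hp8 hq4]
    decide

/-- The diagonal Gram entry at `p`: `(p, p)_V = λ_q(p)² + λ₂(p) = λ_q(p) + 1`.
[cite: Aoki1999, proof of Thm. 2.2 p. 98] -/
theorem gramMatrix_prime_prime (hp : p.Prime) (hq : q.Prime) (hp8 : p % 8 = 5) (hq4 : q % 4 = 3) :
    gramMatrix (2 * (p * q)) ⟨p, prime_mem_sOneSet hp hq hp8 hq4⟩
      ⟨p, prime_mem_sOneSet hp hq hp8 hq4⟩ = lam (2 * (p * q)) q p + 1 := by
  simp only [gramMatrix, Matrix.of_apply, if_true, sum_sTwoSet_eq hp hq hp8 hq4,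
    lam_two_prime_five hp hp8]
  have hsq : ∀ x : ZMod 2, x * x = x := by decide
  have hcomm : ∀ a b : ZMod 2, a * b + b * a = 0 := by decide
  rw [hsq, hcomm, mul_zero, add_zero]

/-- The diagonal Gram entry at `q`: `(q, q)_V = λ_q(q)² + λ₂(q) = λ_q(q) + λ₂(q)`.
[cite: Aoki1999, proof of Thm. 2.2 p. 98] -/
theorem gramMatrix_other_other (hp : p.Prime) (hq : q.Prime) (hp8 : p % 8 = 5) (hq4 : q % 4 = 3) :
    gramMatrix (2 * (p * q)) ⟨q, other_mem_sOneSet hp hq hp8 hq4⟩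
      ⟨q, other_mem_sOneSet hp hq hp8 hq4⟩ = lam (2 * (p * q)) q q + lam (2 * (p * q)) 2 q := by
  simp only [gramMatrix, Matrix.of_apply, if_true, sum_sTwoSet_eq hp hq hp8 hq4]
  have hsq : ∀ x : ZMod 2, x * x = x := by decide
  have hcomm : ∀ a b : ZMod 2, a * b + b * a = 0 := by decide
  rw [hsq, hcomm, mul_zero, add_zero]

/-- Membership in `v_{S₁}(Sel₀)` on the family gives the linear condition
`w_p λ_p(p) + w_q λ_p(q) = 0` (from `λ_p(x_w) = 0`, `p ∈ T`). [cite: Aoki1999, Thm. 4.1 p. 87] -/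
theorem essential_condition (hp : p.Prime) (hq : q.Prime) (hp8 : p % 8 = 5) (hq4 : q % 4 = 3)
    (w : essential (2 * (p * q))) :
    (w : sOneSet (2 * (p * q)) → ZMod 2) ⟨p, prime_mem_sOneSet hp hq hp8 hq4⟩ *
        lam (2 * (p * q)) p p +
      (w : sOneSet (2 * (p * q)) → ZMod 2) ⟨q, other_mem_sOneSet hp hq hp8 hq4⟩ *
        lam (2 * (p * q)) p q = 0 := by
  have hw := (Finset.mem_filter.mp w.2).2.1 p (prime_mem_tSet hp hq hp8 hq4)
  have hn : 2 * (p * q) ≠ 0 := mul_ne_zero two_ne_zero (mul_ne_zero hp.ne_zero hq.ne_zero)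
  rw [lam_rep hn, sum_sOneSet_eq hp hq hp8 hq4] at hw
  exact hw

/-- **The Gram matrix of `( , )_V` on `v_{S₁}(Sel₀)` vanishes on the family** (both Legendre halves):
if `(q/p) = −1` then `λ_p(p) = 0`, `λ_p(q) = 1`, so every `w ∈ v_{S₁}(Sel₀)` has `w_q = 0`, and
`(p, p)_V = λ_q(p) + 1 = 0` (`(p/q) = (q/p) = −1`); if `(q/p) = 1` then `w_p = 0` and
`(q, q)_V = λ_q(q) + λ₂(q) = 0`. This is Lemma 7.3 (`⟨x, x⟩_φ′ = 0`) made explicit on a one-dimensional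
`Sel₀`. [cite: Aoki1999, proof of Thm. 2.2 p. 98, Lemma 7.3 pp. 98–99] -/
theorem gramEssential_two_mul_five_mul (hp : p.Prime) (hq : q.Prime) (hp8 : p % 8 = 5)
    (hq4 : q % 4 = 3) : gramEssential (2 * (p * q)) = 0 := by
  have hrec : jacobiSym q p = jacobiSym p q :=
    jacobiSym.quadratic_reciprocity_one_mod_four' (hq.odd_of_ne_two (by omega)) (by omega)
  have hgcd : Int.gcd (q : ℤ) p = 1 := by
    rw [Int.gcd_natCast_natCast]
    exact (Nat.coprime_primes hq hp).mpr (fun h => by omega)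
  have hpm : jacobiSym q p = 1 ∨ jacobiSym q p = -1 := jacobiSym.eq_one_or_neg_one hgcd
  have hzo : ∀ x : ZMod 2, x ≠ 0 → x = 1 := by decide
  set P : sOneSet (2 * (p * q)) := ⟨p, prime_mem_sOneSet hp hq hp8 hq4⟩ with hP
  set Q : sOneSet (2 * (p * q)) := ⟨q, other_mem_sOneSet hp hq hp8 hq4⟩ with hQ
  ext w w'
  simp only [gramEssential, Matrix.of_apply, Matrix.zero_apply, Matrix.mulVec, dotProduct,
    sum_sOneSet_eq hp hq hp8 hq4]
  rcases hpm with hj | hj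
  · -- `(q/p) = 1`: `w_p = 0` for every essential `w`; the form lives on `e_q` with `(q, q)_V = 0`
    have hpp : lam (2 * (p * q)) p p = 1 := hzo _ (by
      rw [Ne, lam_prime_prime_eq_zero_iff hp hq hp8 hq4, hj]; decide)
    have hpq : lam (2 * (p * q)) p q = 0 := (lam_prime_other_eq_zero_iff hp hq hp8 hq4).mpr hj
    have hqq : gramMatrix (2 * (p * q)) Q Q = 0 := by
      rw [hQ, gramMatrix_other_other hp hq hp8 hq4,
        lam_other_other_eq_lam_two hp hq hp8 hq4 (hrec ▸ hj)]
      exact (by decide : ∀ x : ZMod 2, x + x = 0) _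
    have key : ∀ v : essential (2 * (p * q)), (v : sOneSet (2 * (p * q)) → ZMod 2) P = 0 := by
      intro v
      have := essential_condition hp hq hp8 hq4 v
      rwa [hpp, hpq, mul_one, mul_zero, add_zero] at this
    rw [key w, key w', hqq]
    ring
  · -- `(q/p) = −1`: `w_q = 0` for every essential `w`; the form lives on `e_p` with `(p, p)_V = 0`
    have hpp : lam (2 * (p * q)) p p = 0 := (lam_prime_prime_eq_zero_iff hp hq hp8 hq4).mpr hj
    have hpq : lam (2 * (p * q)) p q = 1 := hzo _ (by
      rw [Ne, lam_prime_other_eq_zero_iff hp hq hp8 hq4, hj]; decide)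
    have hqp : lam (2 * (p * q)) q p = 1 := hzo _ (by
      rw [Ne, lam_other_prime_eq_zero_iff hp hq hp8 hq4, ← hrec, hj]; decide)
    have hPP : gramMatrix (2 * (p * q)) P P = 0 := by
      rw [hP, gramMatrix_prime_prime hp hq hp8 hq4, hqp]
      decide
    have key : ∀ v : essential (2 * (p * q)), (v : sOneSet (2 * (p * q)) → ZMod 2) Q = 0 := by
      intro v
      have := essential_condition hp hq hp8 hq4 v
      rwa [hpp, hpq, mul_zero, mul_one, zero_add] at this
    rw [key w, key w', hPP]
    ring

/-- **Theorem 2.2 evaluated on the family: `dim_{𝔽₂} Sel^(2)(E_{2pq}/ℚ) = 1 + 3 + 1 − 2·1 − 0 = 3`**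
for every `p ≡ 5 (mod 8)`, `q ≡ 3 (mod 4)` (both Legendre halves).
[cite: Aoki1999, Thm. 2.2 p. 81] -/
theorem selmerDimFormula_two_mul_five_mul (hp : p.Prime) (hq : q.Prime) (hp8 : p % 8 = 5)
    (hq4 : q % 4 = 3) : selmerDimFormula (2 * (p * q)) = 3 := by
  unfold selmerDimFormula
  rw [card_sSet_two_mul_five_mul hp hq hp8 hq4, card_tSet_two_mul_five_mul hp hq hp8 hq4,
    rank_lamMatrix_two_mul_five_mul hp hq hp8 hq4, gramEssential_two_mul_five_mul hp hq hp8 hq4,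
    Matrix.rank_zero]
  norm_num

/-- **`#Sel₂(E_{2pq}/ℚ) = 8` for every `p ≡ 5 (mod 8)`, `q ≡ 3 (mod 4)`, from Aoki's Theorem 2.2
alone** (`hAo`; refereed, complete proofs) and the kernel evaluation above. Both Legendre halves; no
Monsky 1990 binder, no Heath-Brown 1994 binder.
[cite: Aoki1999, Thm. 2.2 p. 81] -/
theorem card_selmerGroup_two_two_mul_five_mul_of_aoki (hAo : thm22_card_selmerGroup_two)
    (hp : p.Prime) (hq : q.Prime) (hp8 : p % 8 = 5) (hq4 : q % 4 = 3) :
    Nat.card ((congruentNumberCurve (2 * (p * q))).selmerGroup 2) = 8 := by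
  obtain ⟨hN, -, -, -⟩ := isCor515Family_two_mul_five_mul hp hq hp8 hq4
  obtain ⟨d, hd, hd'⟩ := hAo _ (Nat.pos_of_ne_zero hN.ne_zero) hN.squarefree
    (Or.inr (Or.inl (two_mul_five_mul_mod_eight hp8 hq4)))
  rw [selmerDimFormula_two_mul_five_mul hp hq hp8 hq4] at hd'
  have h3 : d = 3 := by exact_mod_cast hd'
  rw [hd, h3]
  norm_num

end Evaluation

/-! ## §2 The enclosure corners with Aoki's fact: `hAo ⟹ hD`, the datum, C-P2-1 modulo `{hAo, hSys}` / `{hAo, hSys′}` -/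

/-- **Aoki's fact implies the written proof's Selmer bound `hD` on `𝒮⁻`** (`#Sel₂(E_{2pq}) ≤ 8`, PROOF-A
Lemma 7.1 (a) / App. D) — with equality, by `card_selmerGroup_two_two_mul_five_mul_of_aoki`.
[cite: Aoki1999, Thm. 2.2 p. 81] -/
theorem selmer_le_eight_of_aoki (hAo : thm22_card_selmerGroup_two) :
    ∀ p q : ℕ, p.Prime → q.Prime → p % 8 = 5 → q % 4 = 3 → jacobiSym p q = -1 →
      Nat.card ((congruentNumberCurve (2 * (p * q))).selmerGroup 2) ≤ 8 :=
  fun _ _ hp hq hp5 hq4 _ => (card_selmerGroup_two_two_mul_five_mul_of_aoki hAo hp hq hp5 hq4).le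

/-- **Route A ⟹ the odd-index Heegner datum on `𝒮⁻`, with Aoki's fact for the rank**: rank one from
`#Sel₂ = 8` (`hAo`) and the system's own M-y point, then `𝓛` odd from the displayed Gross–Zagier
assembly (`oddIndexHeegnerDatum_of_system_of_selmer_le_eight`). No Monsky 1990 / Heath-Brown 1994 binder.
[cite: Aoki1999, Thm. 2.2 p. 81] [cite: Tian2014, Thm. 2.8 (arXiv:1210.8231 p0011 L25–L44)]
[cite: TianYuanZhang2017, Thm. 3.3] [cite: SilvermanAEC2009, Thm. X.4.2, Thm. VIII.6.7] -/
theorem oddIndexHeegnerDatum_of_system_of_aoki (hAo : thm22_card_selmerGroup_two)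
    (hSys : tian2014_monsky1990_system_sMinus) :
    ∀ p q : ℕ, p.Prime → q.Prime → p % 8 = 5 → q % 4 = 3 → jacobiSym p q = -1 →
      OddIndexHeegnerDatum (2 * (p * q)) :=
  oddIndexHeegnerDatum_of_system_of_selmer_le_eight (selmer_le_eight_of_aoki hAo) hSys

/-- **Rank `1`, `#Sel₂ = 8`, `Ш(E_{2pq})[2^∞] = 0` on `𝒮⁻` as a kernel theorem modulo `hAo` and the system
fact** — Monsky 1990 Cor 5.15 (2′) with Remark (2) on `𝒮⁻`, obtained from Aoki's count and Tian's system.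
[cite: Aoki1999, Thm. 2.2 p. 81] [cite: SilvermanAEC2009, Thm. X.4.2, Thm. VIII.6.7]
[cite: Monsky1990MockHeegner, Cor. 5.15 (2′) (p. 66), Remark (2) (p. 67) — the statement, not an input] -/
theorem cor515_two_mul_five_mul_of_aoki_of_system (hAo : thm22_card_selmerGroup_two)
    (hSys : tian2014_monsky1990_system_sMinus) :
    ∀ p q : ℕ, p.Prime → q.Prime → p % 8 = 5 → q % 4 = 3 → jacobiSym p q = -1 →
      (congruentNumberCurve (2 * (p * q))).mordellWeilRank = 1 ∧
        Nat.card ((congruentNumberCurve (2 * (p * q))).selmerGroup 2) = 8 ∧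
        AddCommGroup.primaryComponent (congruentNumberCurve (2 * (p * q))).sha 2 = ⊥ :=
  cor515_two_mul_five_mul_of_selmer_le_eight_of_oddIndexHeegnerDatum (selmer_le_eight_of_aoki hAo)
    (oddIndexHeegnerDatum_of_system_of_aoki hAo hSys)

/-- **C-P2-1, sharper form, modulo `hAo` and `hSys`.** Conditional; nothing asserted.
[cite: Aoki1999, Thm. 2.2 p. 81] [cite: Tian2014, Thm. 2.8 (arXiv:1210.8231 p0011 L25–L44)]
[cite: TianYuanZhang2017, §1 (definition of 𝓛(n) and (1.1)), Thm. 3.3] -/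
theorem congruentSilentEvenFiveOrdTwo_of_system_of_aoki (hAo : thm22_card_selmerGroup_two)
    (hSys : tian2014_monsky1990_system_sMinus) : CongruentSilentEvenFiveOrdTwo :=
  congruentSilentEvenFiveOrdTwo_of_oddIndexHeegnerDatum_of_selmer_le_eight (selmer_le_eight_of_aoki hAo)
    (oddIndexHeegnerDatum_of_system_of_aoki hAo hSys)

/-- **C-P2-1 modulo `hAo` and `hSys`** — route A's enclosure with Aoki's refereed, fully proved count in
place of the sketch-proved `hMe` or the in-house `hD`. Conditional; nothing asserted.
[cite: Aoki1999, Thm. 2.2 p. 81] [cite: Tian2014, Thm. 2.8 (arXiv:1210.8231 p0011 L25–L44)]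
[cite: TianYuanZhang2017, Thm. 3.3] [cite: Miller2011LMS, Def. 1.1 (arXiv:1010.2431 p. 3)] -/
theorem congruentSilentEvenFiveBSDTwo_of_system_of_aoki (hAo : thm22_card_selmerGroup_two)
    (hSys : tian2014_monsky1990_system_sMinus) : CongruentSilentEvenFiveBSDTwo :=
  congruentSilentEvenFiveBSDTwo_of_system_of_selmer_le_eight (selmer_le_eight_of_aoki hAo) hSys

/-- **C-P2-1, sharper form, modulo `hAo` and the genus form `hSys′`.** Conditional; nothing asserted.
[cite: Aoki1999, Thm. 2.2 p. 81] [cite: Tian2014, Thm. 2.8 (arXiv:1210.8231 p0011 L25–L44)]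
[cite: TianYuanZhang2017, §1 (definition of 𝓛(n) and (1.1)), Thm. 3.3] -/
theorem congruentSilentEvenFiveOrdTwo_of_genusSystem_of_aoki (hAo : thm22_card_selmerGroup_two)
    (hSys' : tian2014_system_sMinus_genus) : CongruentSilentEvenFiveOrdTwo :=
  congruentSilentEvenFiveOrdTwo_of_system_of_aoki hAo (tian2014_monsky1990_system_sMinus_of_genus hSys')

/-- **C-P2-1 modulo `hAo` and the genus form `hSys′`** — the fourth corner of the enclosure with Aoki's
fact: the displayed content of route A on `𝒮⁻` is `hSys′` plus ONE refereed, completely proved printed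
theorem. Conditional; nothing asserted.
[cite: Aoki1999, Thm. 2.2 p. 81] [cite: Tian2014, Thm. 2.8 (arXiv:1210.8231 p0011 L25–L44)]
[cite: TianYuanZhang2017, Thm. 3.3] [cite: Miller2011LMS, Def. 1.1 (arXiv:1010.2431 p. 3)] -/
theorem congruentSilentEvenFiveBSDTwo_of_genusSystem_of_aoki (hAo : thm22_card_selmerGroup_two)
    (hSys' : tian2014_system_sMinus_genus) : CongruentSilentEvenFiveBSDTwo :=
  congruentSilentEvenFiveBSDTwo_of_genusSystem_of_selmer_le_eight (selmer_le_eight_of_aoki hAo) hSys'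

/-! ## §3 The `𝒮⁺` half with `hAo` in place of `hMe`, and the whole even-five two-prime family -/

/-- **THE EVEN HALF-FAMILY `2·p₅·q`, `q ≡ 3 (mod 4)`, `(p/q) = +1`, U⁺ DISCHARGED — Aoki form.**
`bsdp_two_congruentNumberCurve_two_mul_five_mul_of_monskyEven` with `hMe` replaced by `hAo`: rank `1`
from `hGZK` (`ord_{s=1} L = 1` by U⁺), `#Sel₂ = 8` from §1, `Ш[2^∞] = 0` from the descent count, then the
fact-free door. Modulo `hTYZ` (TYZ §3), `hGZK`, `hR` (Rédei–Reichardt), `hAo` (Aoki 1999); nothing per-curve.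
[cite: TianYuanZhang2017, Thm. 1.2, Thm. 3.5 and §1 (1.1)] [cite: Aoki1999, Thm. 2.2 p. 81]
[cite: SilvermanAEC2009, Thm. X.4.2] [cite: Miller2011LMS, Def. 1.1 (arXiv:1010.2431 p. 3)] -/
theorem bsdp_two_congruentNumberCurve_two_mul_five_mul_of_aoki
    (hTYZ : tyz_genusPointData) (hGZK : rank_eq_analyticRank_of_analyticRank_le_one)
    (hR : redeiReichardt_fourTwoCard_classGroup) (hAo : thm22_card_selmerGroup_two)
    {p q : ℕ} (hp : p.Prime) (hq : q.Prime) (hp5 : p % 8 = 5) (hq4 : q % 4 = 3) (hj : jacobiSym p q = 1) :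
    haveI := isElliptic_congruentNumberCurve
      (Nat.mul_ne_zero two_ne_zero (Nat.mul_ne_zero hp.ne_zero hq.ne_zero))
    (congruentNumberCurve (2 * (p * q))).analyticRank = 1 ∧ BSDp (congruentNumberCurve (2 * (p * q))) 2 := by
  have hp2 : p ≠ 2 := by omega
  have hq2 : q ≠ 2 := by omega
  have hne : p ≠ q := fun h => by omega
  obtain ⟨hN, -, -, -⟩ := isCor515Family_two_mul_five_mul hp hq hp5 hq4
  haveI := isElliptic_congruentNumberCurve hN.ne_zero
  haveI : Fact (Nat.Prime 2) := ⟨Nat.prime_two⟩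
  have hsq : Squarefree (2 * (p * q)) := hN.squarefree
  have h6 : (2 * (p * q)) % 8 = 6 := two_mul_five_mul_mod_eight hp5 hq4
  -- U⁺ + `Σ₂′` odd: `𝓛` odd, `ord = 1`, `L′ = 2^e · 𝓛² · Ω · Reg`
  obtain ⟨Lz, hLodd, hr1, hderiv⟩ := rankOneDatum_of_uPlus_six (uPlus_of_genusPointData hTYZ hGZK) hsq h6
    (odd_genusSum₂'_genusField_two_mul_five_mul hR hp hq hp5 hq4 hj)
  have hx : deriv (congruentNumberCurve (2 * (p * q))).entireLFunction 1 =
      (((2 : ℚ) ^ twoExponent (2 * (p * q)) * (Lz : ℚ) ^ 2 : ℚ) : ℂ) *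
        ((congruentNumberCurve (2 * (p * q))).realPeriodRat : ℂ) *
          ((congruentNumberCurve (2 * (p * q))).regulator : ℂ) := by
    rw [hderiv]; push_cast; ring
  have hx0 : (2 : ℚ) ^ twoExponent (2 * (p * q)) * (Lz : ℚ) ^ 2 ≠ 0 := by
    have hL0' : Lz ≠ 0 := fun h => by simp [h] at hLodd
    have hL0 : (Lz : ℚ) ≠ 0 := by exact_mod_cast hL0'
    exact mul_ne_zero (zpow_ne_zero _ two_ne_zero) (pow_ne_zero _ hL0)
  -- GZK: rank `1`; Aoki's formula + the kernel evaluation: `#Sel₂ = 8`; hence `Ш[2^∞] = 0`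
  obtain ⟨hrank, -⟩ := hGZK (congruentNumberCurve (2 * (p * q))) (le_of_eq hr1)
  rw [hr1] at hrank
  have hsel := card_selmerGroup_two_two_mul_five_mul_of_aoki hAo hp hq hp5 hq4
  have hbot := primaryComponent_sha_two_eq_bot_of_card_selmerGroup_eq_eight hN.ne_zero hrank hsel
  obtain ⟨he, htam⟩ := twoExponent_tamagawa_two_mul_prime_mul hp hq hp2 hq2 hne
  obtain ⟨-, hiff⟩ := bsdp_two_congruentNumberCurve_iff_of_rank_one_of_sha_two_eq_bot hN hrank hbot
    (torsionOrder_congruentNumberCurve hsq) hx0 hx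
  refine ⟨hr1, hiff.mpr ?_⟩
  rw [padicValRat_two_zpow_mul_sq hLodd, he, htam, padicValNat.prime_pow]
  norm_num

/-- **`BSD(E_{2pq}, 2)` for ALL primes `p ≡ 5 (mod 8)`, `q ≡ 3 (mod 4)`, from Tian's CM-point system (genus
form) on `𝒮⁻` and Aoki's count** — modulo `hTYZ`, `hGZK`, `hR`, `hAo`, `hSys′`: the whole even-five
two-prime family with neither a Monsky 1990 nor a Heath-Brown 1994 binder. Conditional; nothing asserted.
[cite: TianYuanZhang2017, Thm. 1.2, Thm. 3.5 and §1 (1.1)] [cite: Tian2014, Thm. 2.8 (arXiv:1210.8231 p0011 L25–L44)]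
[cite: Aoki1999, Thm. 2.2 p. 81] [cite: Miller2011LMS, Def. 1.1 (arXiv:1010.2431 p. 3)] -/
theorem forall_bsdp_two_congruentNumberCurve_two_mul_five_mul_of_genusSystem_of_aoki
    (hTYZ : tyz_genusPointData) (hGZK : rank_eq_analyticRank_of_analyticRank_le_one)
    (hR : redeiReichardt_fourTwoCard_classGroup) (hAo : thm22_card_selmerGroup_two)
    (hSys' : tian2014_system_sMinus_genus) :
    ∀ p q : ℕ, p.Prime → q.Prime → p % 8 = 5 → q % 4 = 3 →
      BSDp (congruentNumberCurve (2 * (p * q))) 2 := by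
  intro p q hp hq hp5 hq4
  have hne : p ≠ q := fun h => by omega
  rcases jacobiSym.eq_one_or_neg_one (int_gcd_eq_one_of_primes hp hq hne) with hj | hj
  · exact (bsdp_two_congruentNumberCurve_two_mul_five_mul_of_aoki hTYZ hGZK hR hAo hp hq hp5 hq4 hj).2
  · exact (congruentSilentEvenFiveBSDTwo_of_genusSystem_of_aoki hAo hSys' p q hp hq hp5 hq4 hj).2

end Summit.BirchSwinnertonDyer.Rank1Residual.P2

end
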